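import Mathlib
import HarnessLib
import Summits.HubbardSuperconductivity.HubbardSuperconductivity.Theorems.KLProgrammeKLRegimeEngineScaleZeroIsoTupleG4
import Summits.HubbardSuperconductivity.HubbardSuperconductivity.Theorems.KLProgrammeKLRegimeEngineV8DefsG5

/-!
# (E5-S)₀ of `stub_engine_scale0` at the gen-6 package `klEngGeo5` — UNCONDITIONAL under the stub binders; the scale-`0` rung at
# `(klEngGeo5, klEngQ5 P R)` from (E4)₀ alone

Cell `gate-hubbard-kl`, seat p4 (C5a lead), g8.  The `G`-package of the gen-6 engine child is `klEngGeo5 = klEngGeo4.scaleGains (2^28)`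
(`…EngineV8DefsG5`, k3c2-p2 g5/g6: the gains rider; `CF` is multiplied by `2^28 ≥ 1`, so `klIsoT ^ 4 ≤ klEngGeo5.CF`,
`klIsoT_pow_four_le_klEngGeo5_CF`).  Composing p4 g7's isotropic torus bound (`TorusFourierL2.exists_isoTorusBoundAt`,
`isoTorusBoundAt_klIsoT`, …H10TwoPointLimitIsoTorusSum) with p3 g6's keyed scale-`0` rung (`isoTupleL1AtS_zero_of_isoTorusBoundAt`,
`engineScaleZero_of_isoTorusBoundAt_klIsoT`, …EngineScaleZeroIsoKeyed) at `G := klEngGeo5`, exactly as `…EngineScaleZeroIsoTupleG4` did at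
`klEngGeo4`:

* **`isoTupleL1AtS_zero_klEngGeo5`** — `IsoTupleL1AtS L M klEngGeo5 P β U μ K 0` under EXACTLY the binders of `stub_engine_scale0`
  (raw `FrameOK` binder, thresholds `klEngC₃3` / `klEngU₀3` / `klEngL₃` / `klEngM₃`), with NO further hypothesis;
* **`engineScaleZero_klEngGeo5_of_firstMoments`** — the five-clause scale-`0` conclusion at `(klEngGeo5, klEngQ5 P R)` from (E4)₀
  `EngineFirstMoments L M klEngGeo5 P (klEngQ5 P R) β U μ K 0` alone (V9-keyed value clauses; a V10S-keyed engine slot reads them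
  through k3c2-p3's `engineBoundsAtV10S_of_V9S`-type lifts).

No analysis here; everything is proved upstream. [cite: BenfattoGiulianiMastropietro2006, §2.6 (2.81), §2.8 (2.77)]
-/

namespace Summit.HubbardSuperconductivity.HubbardSuperconductivity.Theorems.EngineV8

set_option linter.dupNamespace false -- summit = problem name (single-conjunct summit), D-0017

noncomputable section

open Real Finset Literature.MathematicalPhysics.QuantumLattice Literature.Probability.LatticeModels
open Summit.HubbardSuperconductivity.HubbardSuperconductivity.Theorems.KLRegimeSplit
open Summit.HubbardSuperconductivity.HubbardSuperconductivity.Theorems.KLProgrammeLegKernels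

/-- **(E5-S)₀ at `klEngGeo5`, unconditionally under the binders of `stub_engine_scale0`**: `IsoTupleL1AtS L M klEngGeo5 P β U μ K 0`.
[cite: BenfattoGiulianiMastropietro2006, §2.6 (2.81)] -/
theorem isoTupleL1AtS_zero_klEngGeo5 (P : SplitConsts) (R : RenConsts) (c : ℝ) (hP : P.WF) (hR : R.WF2) (hc : 0 < c)
    (hc₃ : c ≤ klEngC₃3 P R) (μ : ℝ) (hμ : μ ∈ klWindowC) (U : ℝ) (hU : 0 < U) (hU₀ : U ≤ klEngU₀3 P R c) (β : ℝ)
    (hβ : klBetaMin ≤ β) (hβc : β ≤ Real.exp (c / U ^ 2)) (K : TrigPolyC4v) (hK : FrameOK R U (nScales β) μ K) (L M : ℕ)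
    [NeZero L] [NeZero M] (hL : klEngL₃ β U ≤ L) (hM : klEngM₃ β U L ≤ M) : IsoTupleL1AtS L M klEngGeo5 P β U μ K 0 := by
  obtain ⟨T, h0, h⟩ := TorusFourierL2.exists_isoTorusBoundAt
  exact isoTupleL1AtS_zero_of_isoTorusBoundAt klIsoT_nonneg (isoTorusBoundAt_klIsoT h0 h) P R c hP hR hc hc₃ μ hμ U hU hU₀ β
    hβ hβc K hK L M hL hM klIsoT_pow_four_le_klEngGeo5_CF

/-- **The scale-`0` rung at `(klEngGeo5, klEngQ5 P R)` from (E4)₀ alone**: under the binders of `stub_engine_scale0`,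
`EngineFirstMoments L M klEngGeo5 P (klEngQ5 P R) β U μ K 0` implies the five-clause conclusion (V9-keyed values).
[cite: BenfattoGiulianiMastropietro2006, §2.8 (2.77)] -/
theorem engineScaleZero_klEngGeo5_of_firstMoments (P : SplitConsts) (R : RenConsts) (c : ℝ) (hP : P.WF) (hR : R.WF2)
    (hc : 0 < c) (hc₃ : c ≤ klEngC₃3 P R) (μ : ℝ) (hμ : μ ∈ klWindowC) (U : ℝ) (hU : 0 < U) (hU₀ : U ≤ klEngU₀3 P R c)
    (β : ℝ) (hβ : klBetaMin ≤ β) (hβc : β ≤ Real.exp (c / U ^ 2)) (K : TrigPolyC4v) (hK : FrameOK R U (nScales β) μ K)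
    (L M : ℕ) [NeZero L] [NeZero M] (hL : klEngL₃ β U ≤ L) (hM : klEngM₃ β U L ≤ M)
    (hE4 : EngineFirstMoments L M klEngGeo5 P (klEngQ5 P R) β U μ K 0) :
    KernelNormsV4 L M P (klEngQ5 P R) β U μ K 0 ∧ PairLadderStepAtV9 L M klEngGeo5 P (klEngQ5 P R) β U μ K 0 ∧
      QuarticValueUVAtS2 L M klEngGeo5 P (klEngQ5 P R) β U μ K 0 ∧ EngineFirstMoments L M klEngGeo5 P (klEngQ5 P R) β U μ K 0 ∧
        IsoTupleL1AtS L M klEngGeo5 P β U μ K 0 := by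
  obtain ⟨T, h0, h⟩ := TorusFourierL2.exists_isoTorusBoundAt
  exact engineScaleZero_of_isoTorusBoundAt_klIsoT h0 h klEngGeo5 klEngGeo5_wf klIsoT_pow_four_le_klEngGeo5_CF P R c hP hR hc
    hc₃ μ hμ U hU hU₀ β hβ hβc K hK L M hL hM hE4

/-- **(E4)₀ at `klEngGeo4` suffices** for the `klEngGeo5` rung (k3c2-p1's (E4)₀ closer is `G`-parametric; this is the transfer form for a
`klEngGeo4`-keyed closer, `0 ≤ P.Klam` from `P.WF`). [cite: BenfattoGiulianiMastropietro2006, §2.8 (2.77)] -/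
theorem engineScaleZero_klEngGeo5_of_firstMoments_klEngGeo4 (P : SplitConsts) (R : RenConsts) (c : ℝ) (hP : P.WF) (hR : R.WF2)
    (hc : 0 < c) (hc₃ : c ≤ klEngC₃3 P R) (μ : ℝ) (hμ : μ ∈ klWindowC) (U : ℝ) (hU : 0 < U) (hU₀ : U ≤ klEngU₀3 P R c)
    (β : ℝ) (hβ : klBetaMin ≤ β) (hβc : β ≤ Real.exp (c / U ^ 2)) (K : TrigPolyC4v) (hK : FrameOK R U (nScales β) μ K)
    (L M : ℕ) [NeZero L] [NeZero M] (hL : klEngL₃ β U ≤ L) (hM : klEngM₃ β U L ≤ M)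
    (hE4 : EngineFirstMoments L M klEngGeo4 P (klEngQ5 P R) β U μ K 0) :
    KernelNormsV4 L M P (klEngQ5 P R) β U μ K 0 ∧ PairLadderStepAtV9 L M klEngGeo5 P (klEngQ5 P R) β U μ K 0 ∧
      QuarticValueUVAtS2 L M klEngGeo5 P (klEngQ5 P R) β U μ K 0 ∧ EngineFirstMoments L M klEngGeo5 P (klEngQ5 P R) β U μ K 0 ∧
        IsoTupleL1AtS L M klEngGeo5 P β U μ K 0 :=
  engineScaleZero_klEngGeo5_of_firstMoments P R c hP hR hc hc₃ μ hμ U hU hU₀ β hβ hβc K hK L M hL hM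
    (engineFirstMoments_klEngGeo5_of_klEngGeo4 (zero_le_one.trans hP.1) hE4)

end

end Summit.HubbardSuperconductivity.HubbardSuperconductivity.Theorems.EngineV8
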